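/-
Copyright (c) 2026 The decomp-a2c cell. All rights reserved.
Released under Apache 2.0 license as described in the file LICENSE.
-/
import Summits.AtomisticToContinuum.Crystallization.Theorems.ChartedZeroExcessLayeredLatticeLiouvilleWY

/-!
# ChartedZeroExcessLayeredLatticeLiouville — part WZ «ProfileComparison»: (PC) from numeric thresholds
  (decomp-a2c-lens-2, g58; helper of stmt-AtomisticToContinuum-26636, leaf (PC) `ProfileComparisonAt`; memo NODE-g58d §3)

The assembly of the typed open leaf (PC) `ProfileComparisonAt` (part WN) from parts WX (anchored step) and WY (profile data), up to PURE REAL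
ARITHMETIC.  With the `ϱ`-FREE constants
* `pcSlope c κ₀ ε := 4·modeConst(κ₀−ε/2)·(driftConst + 1)·√864·(anchorWidth + 1) + reanchorConst`, `pcConst := pcSlope²`,
and the load `pcLoad c κ₀ ε ϱ n Nr := (1 + modeConst·K·(392⌊ϱ/c⌋₊ + 1186))·n·Nr + reanchorConst·n/2` (`Nr` stands for `√N`, `N = #idxBall x₀ n`):

* `anchored_bound`: at a scale `n` satisfying the WX thresholds (`512(ϱ/c+2) ≤ n/2`, `1 ≤ L'`, `6L' + 3⌊ϱ/c⌋₊ ≤ n/4`,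
  `anchorWidth + 3⌊ϱ/c⌋₊ ≤ 3L'`, `1372K·pcLoad(n, √N) ≤ √864·L'³`, `stabConst·pcLoad(n, √N) ≤ √864·L'³`), the base profile `cf` of part WY
  satisfies `‖D₃φ(x₀.1, β) − Δcf(β)‖ ≤ pcSlope·(|β − x₀.2| + 1)·ε₁` for every `|β − x₀.2| ≤ n/2` and every `ε₁ > 0` with
  `√(E/(n²N)) ≤ ε₁` (WY `exists_anchor` picks the anchor, WX `anchored_increment_le` bounds);
* `profile_comparison_at`: letting `ε₁ ↓ √(E/(n²N))` (`le_mul_of_forall_eps`, no case split at `E = 0`) and squaring (WY `sq_form_of_norm_le`):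
  the (PC) inequality `n²N‖D₃φ(x₀.1,β) − Δcf(β)‖² ≤ pcConst·(|β − x₀.2| + 1)²·E` with `IsTruncMode (modeField (slopeAt φ x₀) cf)`;
* ★★★ `profileComparisonAt_of_thresholds`: `ProfileComparisonAt (pcConst c κ₀ ε) ϱ n₁ a b w` for EVERY `n₁` beyond which the six closed-form
  numeric thresholds hold (stated with a free `Nr ≥ 0`, `Nr² ≤ 27n³`).

What remains for the column: the existence of such an `n₁ = n₁(ϱ)` (real asymptotics only: `L' := ⌊(n/4 − 3⌊ϱ/c⌋₊)/6⌋₊ ≥ n/48`,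
`Nr ≤ √27·n^{3/2}`, so the load is `O_ϱ(n^{5/2})` against `√864·L'³ ≥ √864·n³/110592`), and the final pairing `modalLipschitzZ_holds` =
WN `modalLipschitzAt_of_profileComparison` ∘ (PC) ∧ VZ `modeRigidAt_of_tail`.
-/

namespace Summit.AtomisticToContinuum.Crystallization.Theorems.ChartedZeroExcessLayeredLatticeLiouville

open Summit.AtomisticToContinuum.Crystallization.Theorems.ChartedPlanarOrderRigidityDoor (E3)
open Finset
open scoped InnerProductSpace RealInnerProductSpace BigOperators

noncomputable section ProfileComparison

variable {c : ℝ} {a b : E3} {w : ℤ → E3}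

/-! ### WZ.1  The constants -/

/-- the `ϱ`-FREE (PC) slope constant `4M(driftConst + 1)√864(anchorWidth + 1) + reanchorConst`. [this file, g58] -/
def pcSlope (c κ₀ ε : ℝ) : ℝ :=
  4 * modeConst c (κ₀ - ε / 2) * (driftConst c κ₀ ε + 1) * Real.sqrt 864 * (((anchorWidth c κ₀ ε : ℕ) : ℝ) + 1) + reanchorConst c κ₀ ε

/-- the slope constant is non-negative. [formal bookkeeping] -/
theorem pcSlope_nonneg (hc : 0 < c) {κ₀ ε : ℝ} (hε : ε < 2 * κ₀) : 0 ≤ pcSlope c κ₀ ε := by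
  have hδ : 0 < κ₀ - ε / 2 := by linarith
  have hM0 := modeConst_nonneg c hδ
  have hD0 := driftConst_nonneg hc κ₀ ε
  have hR0 := reanchorConst_nonneg hc hε
  unfold pcSlope
  positivity

/-- the `ϱ`-FREE (PC) constant `pcSlope²`. [this file, g58] -/
def pcConst (c κ₀ ε : ℝ) : ℝ :=
  pcSlope c κ₀ ε ^ 2

/-- the threshold LOAD `(1 + M·K·(392⌊ϱ/c⌋₊ + 1186))·n·Nr + reanchorConst·n/2` (`Nr` plays `√N`). [this file, g58] -/
def pcLoad (c κ₀ ε ϱ n Nr : ℝ) : ℝ :=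
  (1 + modeConst c (κ₀ - ε / 2) * kernelConst c * (392 * (⌊ϱ / c⌋₊ : ℝ) + 1186)) * n * Nr + reanchorConst c κ₀ ε * (n / 2)

/-! ### WZ.2  Two scalar lemmas -/

/-- density: a bound `x ≤ K·ε₁` for all `ε₁ > 0` above `ε₀ ≥ 0` gives `x ≤ K·ε₀` (no case split at `ε₀ = 0`).
[formal bookkeeping] -/
theorem le_mul_of_forall_eps {x K ε₀ : ℝ} (hK : 0 ≤ K) (hε₀ : 0 ≤ ε₀) (h : ∀ ε₁ : ℝ, 0 < ε₁ → ε₀ ≤ ε₁ → x ≤ K * ε₁) :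
    x ≤ K * ε₀ := by
  refine le_of_forall_pos_le_add fun τ hτ => ?_
  have hK1 : 0 < K + 1 := by linarith
  have hτ' : 0 < τ / (K + 1) := div_pos hτ hK1
  have h1 := h (ε₀ + τ / (K + 1)) (by linarith) (by linarith)
  have h2 : K * (τ / (K + 1)) ≤ τ := by
    rw [← mul_div_assoc, div_le_iff₀ hK1]
    nlinarith
  have e : K * (ε₀ + τ / (K + 1)) = K * ε₀ + K * (τ / (K + 1)) := by ring
  linarith

/-- the energy scale: `√E ≤ n·√N·ε₁` whenever `√(E/(n²N)) ≤ ε₁`. [formal bookkeeping] -/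
theorem sqrt_energy_le_scale {E n N ε₁ : ℝ} (hE : 0 ≤ E) (hn : 0 < n) (hN : 0 < N) (hEε : Real.sqrt (E / (n ^ 2 * N)) ≤ ε₁) :
    Real.sqrt E ≤ n * Real.sqrt N * ε₁ := by
  have hsN : 0 < Real.sqrt N := Real.sqrt_pos.mpr hN
  have e : Real.sqrt (E / (n ^ 2 * N)) * (n * Real.sqrt N) = Real.sqrt E := by
    rw [Real.sqrt_div hE, Real.sqrt_mul (sq_nonneg n), Real.sqrt_sq hn.le]
    exact div_mul_cancel₀ _ (by positivity)
  calc Real.sqrt E = Real.sqrt (E / (n ^ 2 * N)) * (n * Real.sqrt N) := e.symm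
    _ ≤ ε₁ * (n * Real.sqrt N) := mul_le_mul_of_nonneg_right hEε (by positivity)
    _ = n * Real.sqrt N * ε₁ := by ring

/-! ### WZ.3  The anchored bound at every layer of the half column -/

/-- ★★ THE ANCHORED BOUND: under the WX thresholds at scale `n` (in load form), the WY base profile satisfies
`‖D₃φ(x₀.1, β) − Δcf(β)‖ ≤ pcSlope·(|β − x₀.2| + 1)·ε₁` for all `|β − x₀.2| ≤ n/2`, `ε₁ > 0`, `√(E/(n²N)) ≤ ε₁`. [this file, g58] -/
theorem anchored_bound (hc : 0 < c) (hL : IsLayeredCrystal c a b w) {κ₀ ε ϱ : ℝ} (hκ₀ : 0 < κ₀) (hϱ : 0 ≤ ϱ) (hε : ε < 2 * κ₀)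
    (hK : CoerciveZ (layeredKernel a b w) κ₀)
    (hT : ∀ φ : Cell 2 → ℤ → E3, HasFiniteSupport φ → Summable (tailFam ϱ a b w φ) ∧ ∑' x, tailFam ϱ a b w φ x ≤ ε * nnFormZ φ)
    (hP : ∀ E₀ : Cell 2 × ℤ, E₀.2 = 0 → (idxNorm E₀ : ℝ) ≤ 1 → ∀ (y₀ : Cell 2 × ℤ) (r' n' : ℝ), r' < n' → ∀ χ : Cell 2 → ℤ → E3,
      IsTruncHarmonicZ ϱ a b w χ (idxBall y₀ (n' + 1)) →
        κ₀ * idxEnergy (latDiff E₀ χ) (idxBall y₀ r') ≤ 54 * kernelConst c * ((n' - r')⁻¹) ^ 2 * idxEnergy χ (idxBall y₀ (n' + ϱ / c + 1)))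
    (x₀ : Cell 2 × ℤ) {n : ℝ} (hn : 512 * (ϱ / c + 2) ≤ n / 2) {φ : Cell 2 → ℤ → E3} (hφ : IsTruncHarmonicZ ϱ a b w φ (idxBall x₀ n))
    {cf : ℤ → E3} (hF : ∀ m : ℤ, columnFlux ϱ a b w ⌊ϱ / c⌋₊ (slopeAt φ x₀) cf m = colFlux ϱ a b w (colCarrier x₀.2 n) φ x₀.1 x₀.2)
    (hBc : ∀ k : ℤ, ‖cf (k + 1) - cf k‖ ≤
      modeConst c (κ₀ - ε / 2) * kernelConst c * (392 * (⌊ϱ / c⌋₊ : ℝ) + 1186) * Real.sqrt (idxEnergy φ (idxBall x₀ n)))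
    {L' : ℕ} (hL' : 1 ≤ L') (hL6 : 6 * (L' : ℝ) + 3 * (⌊ϱ / c⌋₊ : ℝ) ≤ n / 4) (hAL : anchorWidth c κ₀ ε + 3 * ⌊ϱ / c⌋₊ ≤ 3 * L')
    (hL1 : 1372 * kernelConst c * pcLoad c κ₀ ε ϱ n (Real.sqrt ((idxBall x₀ n).ncard : ℝ)) ≤ Real.sqrt 864 * ((L' : ℕ) : ℝ) ^ 3)
    (hL2 : stabConst c (κ₀ - ε / 2) * pcLoad c κ₀ ε ϱ n (Real.sqrt ((idxBall x₀ n).ncard : ℝ)) ≤ Real.sqrt 864 * ((L' : ℕ) : ℝ) ^ 3)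
    {ε₁ : ℝ} (hε₁ : 0 < ε₁) (hEε : Real.sqrt (idxEnergy φ (idxBall x₀ n) / (n ^ 2 * ((idxBall x₀ n).ncard : ℝ))) ≤ ε₁)
    {β : ℤ} (hβ : |((β - x₀.2 : ℤ) : ℝ)| ≤ n / 2) :
    ‖latDiff idxAxis₃ φ x₀.1 β - (cf (β + 1) - cf β)‖ ≤ pcSlope c κ₀ ε * (|((β - x₀.2 : ℤ) : ℝ)| + 1) * ε₁ := by
  -- constants
  have hδ : 0 < κ₀ - ε / 2 := by linarith
  have hM0 := modeConst_nonneg c hδ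
  have hK0 := kernelConst_nonneg hc
  have hD0 := driftConst_nonneg hc κ₀ ε
  have hR0 := reanchorConst_nonneg hc hε
  have hr0 : (0 : ℝ) ≤ (⌊ϱ / c⌋₊ : ℝ) := Nat.cast_nonneg _
  have hρc : 0 ≤ ϱ / c := div_nonneg hϱ hc.le
  have hn0 : 0 < n := by linarith
  have hN := ncard_idxBall_pos x₀ hn0.le
  have hE0 := idxEnergy_nonneg φ (idxBall x₀ n)
  have hA0 : (0 : ℝ) ≤ ((anchorWidth c κ₀ ε : ℕ) : ℝ) := Nat.cast_nonneg _
  have ht0 : 0 ≤ |((β - x₀.2 : ℤ) : ℝ)| := abs_nonneg _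
  -- the anchor
  have hAL' : anchorWidth c κ₀ ε ≤ 3 * L' := le_trans (Nat.le_add_right _ _) hAL
  have hALr : ((anchorWidth c κ₀ ε : ℕ) : ℝ) + 3 * (⌊ϱ / c⌋₊ : ℝ) ≤ 3 * (L' : ℝ) := by exact_mod_cast hAL
  obtain ⟨s, hs1, hs2, hs3, hs4⟩ := exists_anchor (β - x₀.2) hAL'
  have et : ((((β - x₀.2).natAbs : ℕ)) : ℝ) = |((β - x₀.2 : ℤ) : ℝ)| := by rw [Nat.cast_natAbs, Int.cast_abs]
  have hs_abs : |((s : ℤ) : ℝ)| ≤ |((β - x₀.2 : ℤ) : ℝ)| := by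
    have h := abs_cast_le_of_natAbs_le hs2
    rwa [et] at h
  have hs_real : |((s : ℤ) : ℝ)| + 3 * (⌊ϱ / c⌋₊ : ℝ) ≤ n / 2 := by
    rcases hs4 with h0 | h4
    · rw [h0, Int.cast_zero, abs_zero]
      have hL1r : (1 : ℝ) ≤ (L' : ℝ) := by exact_mod_cast hL'
      linarith
    · have hle : s.natAbs ≤ (β - x₀.2).natAbs - (3 * L' - anchorWidth c κ₀ ε) := by omega
      have h5 := abs_cast_le_of_natAbs_le hle
      have e5 : ((((β - x₀.2).natAbs - (3 * L' - anchorWidth c κ₀ ε) : ℕ)) : ℝ) =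
          |((β - x₀.2 : ℤ) : ℝ)| - (3 * (L' : ℝ) - ((anchorWidth c κ₀ ε : ℕ) : ℝ)) := by
        rw [Nat.cast_sub (by omega : 3 * L' - anchorWidth c κ₀ ε ≤ (β - x₀.2).natAbs), Nat.cast_sub hAL', et]
        push_cast
        ring
      rw [e5] at h5
      linarith
  -- the thresholds in the form of part WX
  have hroot := sqrt_energy_le_scale hE0 hn0 hN hEε
  have hB : Real.sqrt (idxEnergy φ (idxBall x₀ n)) +
      modeConst c (κ₀ - ε / 2) * kernelConst c * (392 * (⌊ϱ / c⌋₊ : ℝ) + 1186) * Real.sqrt (idxEnergy φ (idxBall x₀ n)) +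
        reanchorConst c κ₀ ε * (n / 2) * ε₁ ≤ pcLoad c κ₀ ε ϱ n (Real.sqrt ((idxBall x₀ n).ncard : ℝ)) * ε₁ := by
    have h1 := mul_le_mul_of_nonneg_left hroot
      (by positivity : (0 : ℝ) ≤ 1 + modeConst c (κ₀ - ε / 2) * kernelConst c * (392 * (⌊ϱ / c⌋₊ : ℝ) + 1186))
    calc Real.sqrt (idxEnergy φ (idxBall x₀ n)) +
        modeConst c (κ₀ - ε / 2) * kernelConst c * (392 * (⌊ϱ / c⌋₊ : ℝ) + 1186) * Real.sqrt (idxEnergy φ (idxBall x₀ n)) +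
          reanchorConst c κ₀ ε * (n / 2) * ε₁
        = (1 + modeConst c (κ₀ - ε / 2) * kernelConst c * (392 * (⌊ϱ / c⌋₊ : ℝ) + 1186)) * Real.sqrt (idxEnergy φ (idxBall x₀ n)) +
            reanchorConst c κ₀ ε * (n / 2) * ε₁ := by ring
      _ ≤ (1 + modeConst c (κ₀ - ε / 2) * kernelConst c * (392 * (⌊ϱ / c⌋₊ : ℝ) + 1186)) *
            (n * Real.sqrt ((idxBall x₀ n).ncard : ℝ) * ε₁) + reanchorConst c κ₀ ε * (n / 2) * ε₁ := by linarith
      _ = pcLoad c κ₀ ε ϱ n (Real.sqrt ((idxBall x₀ n).ncard : ℝ)) * ε₁ := by unfold pcLoad; ring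
  have hL1' : 1372 * kernelConst c * (pcLoad c κ₀ ε ϱ n (Real.sqrt ((idxBall x₀ n).ncard : ℝ)) * ε₁) ≤
      ((L' : ℕ) : ℝ) ^ 3 * (Real.sqrt 864 * ε₁) := by
    calc 1372 * kernelConst c * (pcLoad c κ₀ ε ϱ n (Real.sqrt ((idxBall x₀ n).ncard : ℝ)) * ε₁)
        = (1372 * kernelConst c * pcLoad c κ₀ ε ϱ n (Real.sqrt ((idxBall x₀ n).ncard : ℝ))) * ε₁ := by ring
      _ ≤ (Real.sqrt 864 * ((L' : ℕ) : ℝ) ^ 3) * ε₁ := mul_le_mul_of_nonneg_right hL1 hε₁.le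
      _ = _ := by ring
  have hL2' : stabConst c (κ₀ - ε / 2) * (pcLoad c κ₀ ε ϱ n (Real.sqrt ((idxBall x₀ n).ncard : ℝ)) * ε₁) ≤
      ((L' : ℕ) : ℝ) ^ 3 * (Real.sqrt 864 * ε₁) := by
    calc stabConst c (κ₀ - ε / 2) * (pcLoad c κ₀ ε ϱ n (Real.sqrt ((idxBall x₀ n).ncard : ℝ)) * ε₁)
        = (stabConst c (κ₀ - ε / 2) * pcLoad c κ₀ ε ϱ n (Real.sqrt ((idxBall x₀ n).ncard : ℝ))) * ε₁ := by ring
      _ ≤ (Real.sqrt 864 * ((L' : ℕ) : ℝ) ^ 3) * ε₁ := mul_le_mul_of_nonneg_right hL2 hε₁.le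
      _ = _ := by ring
  have hβ' : (β - (x₀.2 + s)).natAbs + anchorWidth c κ₀ ε ≤ 3 * L' := by
    have e : β - (x₀.2 + s) = β - x₀.2 - s := by ring
    rw [e]
    exact hs1
  -- the anchored step of part WX
  have hmain := anchored_increment_le hc hL hκ₀ hϱ hε hK hT hP x₀ hn hφ (T := colCarrier x₀.2 n) (fun β' h => mem_colCarrier h) hF hBc
    hε₁ hEε s hs_real (one_le_anchorWidth c κ₀ ε) hL' hL6 (anchorWidth_cube c κ₀ ε) (anchorWidth_sq c κ₀ ε) hB hL1' hL2' hβ'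
  -- bookkeeping of the offsets
  have h6 : ((((β - (x₀.2 + s)).natAbs : ℕ)) : ℝ) ≤ |((β - x₀.2 : ℤ) : ℝ)| := by
    have h : ((((β - (x₀.2 + s)).natAbs : ℕ)) : ℝ) ≤ ((((β - x₀.2).natAbs : ℕ)) : ℝ) := by
      have hz : (β - (x₀.2 + s)).natAbs ≤ (β - x₀.2).natAbs := by
        have e : β - (x₀.2 + s) = β - x₀.2 - s := by ring
        rw [e]
        exact hs3
      exact_mod_cast hz
    linarith [et]
  have hP1 : ((((β - (x₀.2 + s)).natAbs : ℕ)) : ℝ) + ((anchorWidth c κ₀ ε : ℕ) : ℝ) ≤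
      (((anchorWidth c κ₀ ε : ℕ) : ℝ) + 1) * (|((β - x₀.2 : ℤ) : ℝ)| + 1) := by
    have e : (((anchorWidth c κ₀ ε : ℕ) : ℝ) + 1) * (|((β - x₀.2 : ℤ) : ℝ)| + 1) =
        ((anchorWidth c κ₀ ε : ℕ) : ℝ) * |((β - x₀.2 : ℤ) : ℝ)| + ((anchorWidth c κ₀ ε : ℕ) : ℝ) + |((β - x₀.2 : ℤ) : ℝ)| + 1 := by ring
    rw [e]
    nlinarith [mul_nonneg hA0 ht0]
  have hP2 : |((s : ℤ) : ℝ)| ≤ |((β - x₀.2 : ℤ) : ℝ)| + 1 := by linarith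
  have hX0 : 0 ≤ 4 * modeConst c (κ₀ - ε / 2) * (driftConst c κ₀ ε + 1) * Real.sqrt 864 := by positivity
  calc ‖latDiff idxAxis₃ φ x₀.1 β - (cf (β + 1) - cf β)‖
      ≤ (4 * modeConst c (κ₀ - ε / 2) * (driftConst c κ₀ ε + 1) * Real.sqrt 864 *
            (((((β - (x₀.2 + s)).natAbs : ℕ)) : ℝ) + ((anchorWidth c κ₀ ε : ℕ) : ℝ)) +
          reanchorConst c κ₀ ε * |((s : ℤ) : ℝ)|) * ε₁ := hmain
    _ ≤ (4 * modeConst c (κ₀ - ε / 2) * (driftConst c κ₀ ε + 1) * Real.sqrt 864 *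
            ((((anchorWidth c κ₀ ε : ℕ) : ℝ) + 1) * (|((β - x₀.2 : ℤ) : ℝ)| + 1)) +
          reanchorConst c κ₀ ε * (|((β - x₀.2 : ℤ) : ℝ)| + 1)) * ε₁ :=
        mul_le_mul_of_nonneg_right (add_le_add (mul_le_mul_of_nonneg_left hP1 hX0) (mul_le_mul_of_nonneg_left hP2 hR0)) hε₁.le
    _ = pcSlope c κ₀ ε * (|((β - x₀.2 : ℤ) : ℝ)| + 1) * ε₁ := by unfold pcSlope; ring

/-! ### WZ.4  (PC) at one scale, and (PC) from the thresholds -/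

/-- ★★ (PC) AT ONE SCALE: under the WX thresholds at scale `n` (load form), the WY base profile is a truncated mode with the (PC) inequality
`n²N‖D₃φ(x₀.1,β) − Δcf(β)‖² ≤ pcConst·(|β − x₀.2| + 1)²·E` on the half column. [this file, g58] -/
theorem profile_comparison_at (hc : 0 < c) (hL : IsLayeredCrystal c a b w) {κ₀ ε ϱ : ℝ} (hκ₀ : 0 < κ₀) (hϱ : 0 ≤ ϱ) (hε : ε < 2 * κ₀)
    (hK : CoerciveZ (layeredKernel a b w) κ₀)
    (hT : ∀ φ : Cell 2 → ℤ → E3, HasFiniteSupport φ → Summable (tailFam ϱ a b w φ) ∧ ∑' x, tailFam ϱ a b w φ x ≤ ε * nnFormZ φ)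
    (hP : ∀ E₀ : Cell 2 × ℤ, E₀.2 = 0 → (idxNorm E₀ : ℝ) ≤ 1 → ∀ (y₀ : Cell 2 × ℤ) (r' n' : ℝ), r' < n' → ∀ χ : Cell 2 → ℤ → E3,
      IsTruncHarmonicZ ϱ a b w χ (idxBall y₀ (n' + 1)) →
        κ₀ * idxEnergy (latDiff E₀ χ) (idxBall y₀ r') ≤ 54 * kernelConst c * ((n' - r')⁻¹) ^ 2 * idxEnergy χ (idxBall y₀ (n' + ϱ / c + 1)))
    (x₀ : Cell 2 × ℤ) {n : ℝ} (hn : 512 * (ϱ / c + 2) ≤ n / 2) {φ : Cell 2 → ℤ → E3} (hφ : IsTruncHarmonicZ ϱ a b w φ (idxBall x₀ n))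
    {L' : ℕ} (hL' : 1 ≤ L') (hL6 : 6 * (L' : ℝ) + 3 * (⌊ϱ / c⌋₊ : ℝ) ≤ n / 4) (hAL : anchorWidth c κ₀ ε + 3 * ⌊ϱ / c⌋₊ ≤ 3 * L')
    (hL1 : 1372 * kernelConst c * pcLoad c κ₀ ε ϱ n (Real.sqrt ((idxBall x₀ n).ncard : ℝ)) ≤ Real.sqrt 864 * ((L' : ℕ) : ℝ) ^ 3)
    (hL2 : stabConst c (κ₀ - ε / 2) * pcLoad c κ₀ ε ϱ n (Real.sqrt ((idxBall x₀ n).ncard : ℝ)) ≤ Real.sqrt 864 * ((L' : ℕ) : ℝ) ^ 3) :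
    ∃ cf : ℤ → E3, IsTruncMode ϱ a b w (modeField (slopeAt φ x₀) cf) ∧ ∀ β : ℤ, |((β - x₀.2 : ℤ) : ℝ)| ≤ n / 2 →
      n ^ 2 * ((idxBall x₀ n).ncard : ℝ) * ‖latDiff idxAxis₃ φ x₀.1 β - (cf (β + 1) - cf β)‖ ^ 2 ≤
        pcConst c κ₀ ε * (|((β - x₀.2 : ℤ) : ℝ)| + 1) ^ 2 * idxEnergy φ (idxBall x₀ n) := by
  have hr0 : (0 : ℝ) ≤ (⌊ϱ / c⌋₊ : ℝ) := Nat.cast_nonneg _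
  have hρc : 0 ≤ ϱ / c := div_nonneg hϱ hc.le
  have hrle : (⌊ϱ / c⌋₊ : ℝ) ≤ ϱ / c := Nat.floor_le hρc
  have hn0 : 0 < n := by linarith
  have hN := ncard_idxBall_pos x₀ hn0.le
  have hE0 := idxEnergy_nonneg φ (idxBall x₀ n)
  have hC0 := pcSlope_nonneg hc hε
  have hn' : 4 * (⌊ϱ / c⌋₊ : ℝ) + 2 ≤ n := by linarith
  have hTx : Icc (x₀.2 - ⌊ϱ / c⌋₊) (x₀.2 + 1 + ⌊ϱ / c⌋₊) ⊆ colCarrier x₀.2 n := box_subset_colCarrier x₀.2 (by linarith)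
  obtain ⟨cf, hMode, hF, hBc⟩ := base_profile hc hL hϱ hε hK hT φ x₀ hn' hTx
  refine ⟨cf, hMode, fun β hβ => ?_⟩
  have ht0 : 0 ≤ |((β - x₀.2 : ℤ) : ℝ)| := abs_nonneg _
  have hv : ‖latDiff idxAxis₃ φ x₀.1 β - (cf (β + 1) - cf β)‖ ≤ pcSlope c κ₀ ε * (|((β - x₀.2 : ℤ) : ℝ)| + 1) *
      Real.sqrt (idxEnergy φ (idxBall x₀ n) / (n ^ 2 * ((idxBall x₀ n).ncard : ℝ))) :=
    le_mul_of_forall_eps (by positivity) (Real.sqrt_nonneg _) fun ε₁ hε₁ hEε =>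
      anchored_bound hc hL hκ₀ hϱ hε hK hT hP x₀ hn hφ hF hBc hL' hL6 hAL hL1 hL2 hε₁ hEε hβ
  have h := sq_form_of_norm_le hn0 hN hE0 hv
  unfold pcConst
  exact h

/-- ★★★ (PC) FROM THE THRESHOLDS: `ProfileComparisonAt (pcConst c κ₀ ε) ϱ n₁ a b w` for every `n₁` beyond which the six closed-form numeric
thresholds of parts WX/WY hold (with a free `Nr ≥ 0`, `Nr² ≤ 27n³` in place of `√N`).  The constant is `ϱ`-FREE; only `n₁` may depend on `ϱ`.
[this file, g58] -/
theorem profileComparisonAt_of_thresholds (hc : 0 < c) (hL : IsLayeredCrystal c a b w) {κ₀ ε ϱ : ℝ} (hκ₀ : 0 < κ₀) (hϱ : 0 ≤ ϱ)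
    (hε : ε < 2 * κ₀) (hK : CoerciveZ (layeredKernel a b w) κ₀)
    (hT : ∀ φ : Cell 2 → ℤ → E3, HasFiniteSupport φ → Summable (tailFam ϱ a b w φ) ∧ ∑' x, tailFam ϱ a b w φ x ≤ ε * nnFormZ φ)
    (hP : ∀ E₀ : Cell 2 × ℤ, E₀.2 = 0 → (idxNorm E₀ : ℝ) ≤ 1 → ∀ (y₀ : Cell 2 × ℤ) (r' n' : ℝ), r' < n' → ∀ χ : Cell 2 → ℤ → E3,
      IsTruncHarmonicZ ϱ a b w χ (idxBall y₀ (n' + 1)) →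
        κ₀ * idxEnergy (latDiff E₀ χ) (idxBall y₀ r') ≤ 54 * kernelConst c * ((n' - r')⁻¹) ^ 2 * idxEnergy χ (idxBall y₀ (n' + ϱ / c + 1)))
    {n₁ : ℝ}
    (hthr : ∀ n : ℝ, n₁ ≤ n → 512 * (ϱ / c + 2) ≤ n / 2 ∧ ∃ L' : ℕ, 1 ≤ L' ∧ 6 * (L' : ℝ) + 3 * (⌊ϱ / c⌋₊ : ℝ) ≤ n / 4 ∧
      anchorWidth c κ₀ ε + 3 * ⌊ϱ / c⌋₊ ≤ 3 * L' ∧ ∀ Nr : ℝ, 0 ≤ Nr → Nr ^ 2 ≤ 27 * n ^ 3 →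
        1372 * kernelConst c * pcLoad c κ₀ ε ϱ n Nr ≤ Real.sqrt 864 * ((L' : ℕ) : ℝ) ^ 3 ∧
        stabConst c (κ₀ - ε / 2) * pcLoad c κ₀ ε ϱ n Nr ≤ Real.sqrt 864 * ((L' : ℕ) : ℝ) ^ 3) :
    ProfileComparisonAt (pcConst c κ₀ ε) ϱ n₁ a b w := by
  intro φ x₀ n hn hφ
  obtain ⟨hn2, L', hL', hL6, hAL, hNr⟩ := hthr n hn
  have hρc : 0 ≤ ϱ / c := div_nonneg hϱ hc.le
  have hn1 : 1 ≤ n := by linarith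
  have hNsq : Real.sqrt ((idxBall x₀ n).ncard : ℝ) ^ 2 ≤ 27 * n ^ 3 := by
    rw [Real.sq_sqrt (Nat.cast_nonneg _)]
    exact ncard_idxBall_le_cube x₀ hn1
  obtain ⟨hL1, hL2⟩ := hNr _ (Real.sqrt_nonneg _) hNsq
  exact profile_comparison_at hc hL hκ₀ hϱ hε hK hT hP x₀ hn2 hφ hL' hL6 hAL hL1 hL2

/-! ### WZ.5  The closed statement of this part -/

/-- The content of part WZ as one closed proposition: (PC) with the `ϱ`-free constant `pcConst` from the numeric thresholds. -/
def ProfileComparisonShape : Prop :=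
  ∀ c : ℝ, ∀ hc : 0 < c, ∀ (a b : E3) (w : ℤ → E3), ∀ hL : IsLayeredCrystal c a b w, ∀ κ₀ ε ϱ : ℝ, 0 < κ₀ → 0 ≤ ϱ → ε < 2 * κ₀ →
    CoerciveZ (layeredKernel a b w) κ₀ →
    (∀ φ : Cell 2 → ℤ → E3, HasFiniteSupport φ → Summable (tailFam ϱ a b w φ) ∧ ∑' x, tailFam ϱ a b w φ x ≤ ε * nnFormZ φ) →
    (∀ E₀ : Cell 2 × ℤ, E₀.2 = 0 → (idxNorm E₀ : ℝ) ≤ 1 → ∀ (y₀ : Cell 2 × ℤ) (r' n' : ℝ), r' < n' → ∀ χ : Cell 2 → ℤ → E3,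
      IsTruncHarmonicZ ϱ a b w χ (idxBall y₀ (n' + 1)) →
        κ₀ * idxEnergy (latDiff E₀ χ) (idxBall y₀ r') ≤ 54 * kernelConst c * ((n' - r')⁻¹) ^ 2 * idxEnergy χ (idxBall y₀ (n' + ϱ / c + 1))) →
    ∀ n₁ : ℝ, (∀ n : ℝ, n₁ ≤ n → 512 * (ϱ / c + 2) ≤ n / 2 ∧ ∃ L' : ℕ, 1 ≤ L' ∧ 6 * (L' : ℝ) + 3 * (⌊ϱ / c⌋₊ : ℝ) ≤ n / 4 ∧
      anchorWidth c κ₀ ε + 3 * ⌊ϱ / c⌋₊ ≤ 3 * L' ∧ ∀ Nr : ℝ, 0 ≤ Nr → Nr ^ 2 ≤ 27 * n ^ 3 →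
        1372 * kernelConst c * pcLoad c κ₀ ε ϱ n Nr ≤ Real.sqrt 864 * ((L' : ℕ) : ℝ) ^ 3 ∧
        stabConst c (κ₀ - ε / 2) * pcLoad c κ₀ ε ϱ n Nr ≤ Real.sqrt 864 * ((L' : ℕ) : ℝ) ^ 3) →
    ProfileComparisonAt (pcConst c κ₀ ε) ϱ n₁ a b w

/-- WZ holds. [this file, g58] -/
theorem profileComparisonShape_holds : ProfileComparisonShape :=
  fun _c hc _a _b _w hL _κ₀ _ε _ϱ hκ₀ hϱ hε hK hT hP _n₁ hthr => profileComparisonAt_of_thresholds hc hL hκ₀ hϱ hε hK hT hP hthr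

end ProfileComparison

end Summit.AtomisticToContinuum.Crystallization.Theorems.ChartedZeroExcessLayeredLatticeLiouville
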